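import Literature.Geometry.Symplectic.SphereCROperatorDerivativeZero
import Literature.Analysis.Complex.RiemannSphereAutomaticTransversality
import Literature.Analysis.Complex.RiemannSphereTangentialSlice
import Literature.Analysis.Calculus.BorderedBlockTriangular
import Literature.Analysis.Calculus.ContDiffCodRestrict
import HarnessLib

/-!
# The linearised chart Cauchy–Riemann operator at the zero section is a bordered isomorphism

Layer B4c/B5 of the analytic core of the Hofer–Lizan–Sikorav local foliation theorem (Wendl 2018,
Thm. 2.46; lead of crux `WitnessCharge`, summit `SmoothPoincare4`). For chart data
`𝒥 : SphereACData` the pieces `PT`, `PN` of the chart Cauchy–Riemann operators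
(`SphereCROperatorBanach.lean`) take values in the section spaces
`𝓗T' = 𝓗^{k,r}_{dbarClutch (-w²)}`, `𝓗N' = 𝓗^{k,r}_{dbarClutch 1}` on the small set; we package them
as maps `FT : SecPair k r → 𝓗T'`, `FN : SecPair k r → 𝓗N'` (`C^∞` on the small set,
`contDiffOn_FT/FN`; zero at `0`) with derivatives `LT`, `LN` at `0` (`hasFDerivAt_FT/FN`). For
`k ≥ 1` the chartwise formulas of `SphereCROperatorDerivativeZero.lean` identify the blocks:

* `LN (δξ, δf) = T₂ δf` with `T₂ = 2 ∂̄ + A` (`T₂_eq`: `2 • dbarOne + formMul a₀ a₁ ∘ incl`, the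
  coefficient fields `aCoeff₀`, `aCoeff₁` clutching by `aCoeff_clutch`);
* `LT (δξ, δf) = T₁ δξ + M δf` with `T₁ = 2 ∂̄_T` (`T₁_eq`: `2 • dbarSec` on `𝓗_{-w²}`).

Hence the BORDERED linearisation
`(δξ, δf) ↦ ((LT δ, LN δ), (slice₃ δξ, δf(0)))` is `blockTriangular T₁ slice₃ T₂ ev₀ M`, a
bijection by back substitution (`bijective_blockTriangular_clm`) from the two bordered diagonal
isomorphisms — the tangential slice theorem (`bijective_smul_dbarSec_prod_slice₃`) and automatic
transversality (`bijective_dbar_add_formMul_prod_eval`) — and a linear homeomorphism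
`linEquiv : SecPair k r ≃L (𝓗T' × 𝓗N') × ((ℂ × ℂ × ℂ) × ℂ)` (Banach open mapping).

## References

* C. Wendl, *Holomorphic Curves in Low Dimensions*, LNM 2216 (2018), §2.3, Thm. 2.46. [Wendl2018]
-/

noncomputable section

open Set Filter Metric Function Complex
open scoped Topology NNReal ContDiff
open Literature.Analysis.FunctionSpaces Literature.Analysis.Complex.RiemannSphere
open Literature.Analysis.Complex.ProjectiveLineExpChart Literature.Geometry.Symplectic.CRExpression
open Literature.Analysis.Complex Literature.Analysis.Calculus

namespace Literature.Geometry.Symplectic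

namespace SphereCR

namespace SphereACData

variable (𝒥 : SphereACData) {r : ℝ≥0} (hr : r ≤ 1) (k : ℕ)

/-! ### The operators with values in the section spaces -/

/-- **The tangent part of the chart Cauchy–Riemann operator as a map into
`𝓗T' = 𝓗^{k,r}_{dbarClutch (-w²)}`** (the honest codomain restriction on the small set, `0`
elsewhere). [cite: Wendl2018, Thm. 2.46] -/
def FT (y : SecPair k r) : holderSections ℂ (dbarClutch (fun w : ℂ => -w ^ 2)) k r := by
  classical
  exact if h : 𝒥.PT hr k y ∈ holderSections ℂ (dbarClutch (fun w : ℂ => -w ^ 2)) k r then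
    ⟨𝒥.PT hr k y, h⟩ else 0

/-- **The normal part as a map into `𝓗N' = 𝓗^{k,r}_{dbarClutch 1}`.** [cite: Wendl2018, Thm. 2.46] -/
def FN (y : SecPair k r) : holderSections ℂ (dbarClutch (1 : ℂ → ℂ)) k r := by
  classical
  exact if h : 𝒥.PN hr k y ∈ holderSections ℂ (dbarClutch (1 : ℂ → ℂ)) k r then ⟨𝒥.PN hr k y, h⟩ else 0

variable {hr k} in
/-- On the small set `FT` is `PT`. [folklore] -/
theorem coe_FT_of_small {y : SecPair k r} (hy : Small hr k y) :
    ((𝒥.FT hr k y : holderSections ℂ (dbarClutch (fun w : ℂ => -w ^ 2)) k r) :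
      ContDiffHolderFunction ℂ ℂ k r × ContDiffHolderFunction ℂ ℂ k r) = 𝒥.PT hr k y := by
  unfold FT
  rw [dif_pos (𝒥.PT_mem hy)]

variable {hr k} in
/-- On the small set `FN` is `PN`. [folklore] -/
theorem coe_FN_of_small {y : SecPair k r} (hy : Small hr k y) :
    ((𝒥.FN hr k y : holderSections ℂ (dbarClutch (1 : ℂ → ℂ)) k r) :
      ContDiffHolderFunction ℂ ℂ k r × ContDiffHolderFunction ℂ ℂ k r) = 𝒥.PN hr k y := by
  unfold FN
  rw [dif_pos (𝒥.PN_mem hy)]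

/-- `FT 0 = 0`. [folklore] -/
theorem FT_zero : 𝒥.FT hr k 0 = 0 :=
  Subtype.ext (by rw [𝒥.coe_FT_of_small (small_zero hr k), 𝒥.PT_zero]; rfl)

/-- `FN 0 = 0`. [folklore] -/
theorem FN_zero : 𝒥.FN hr k 0 = 0 :=
  Subtype.ext (by rw [𝒥.coe_FN_of_small (small_zero hr k), 𝒥.PN_zero]; rfl)

/-- The small set is a neighbourhood of `0`. [folklore] -/
theorem small_mem_nhds : {y : SecPair k r | Small hr k y} ∈ 𝓝 (0 : SecPair k r) :=
  (isOpen_small hr k).mem_nhds (small_zero hr k)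

/-- **`FT` is `C^∞` on the small set** (a `C^∞` map with values in a closed submodule).
[folklore] -/
theorem contDiffOn_FT : ContDiffOn ℝ ∞ (𝒥.FT hr k) {y : SecPair k r | Small hr k y} := by
  refine contDiffOn_of_linearIsometry_comp (𝕜 := ℝ)
    (holderSections ℂ (dbarClutch (fun w : ℂ => -w ^ 2)) k r).subtypeₗᵢ
    (by rw [range_subtypeₗᵢ]; exact isClosed_holderSections)
    (isOpen_small hr k).uniqueDiffOn ?_
  exact (𝒥.contDiff_PT hr k).contDiffOn.congr fun y hy => 𝒥.coe_FT_of_small hy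

/-- **`FN` is `C^∞` on the small set.** [folklore] -/
theorem contDiffOn_FN : ContDiffOn ℝ ∞ (𝒥.FN hr k) {y : SecPair k r | Small hr k y} := by
  refine contDiffOn_of_linearIsometry_comp (𝕜 := ℝ)
    (holderSections ℂ (dbarClutch (1 : ℂ → ℂ)) k r).subtypeₗᵢ
    (by rw [range_subtypeₗᵢ]; exact isClosed_holderSections)
    (isOpen_small hr k).uniqueDiffOn ?_
  exact (𝒥.contDiff_PN hr k).contDiffOn.congr fun y hy => 𝒥.coe_FN_of_small hy

/-- The derivative `dPT 0` takes values in `𝓗T'` (the values of `PT` near `0` do, and the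
submodule is closed). [folklore] -/
theorem dPT_zero_mem (δ : SecPair k r) :
    𝒥.dPT hr k 0 δ ∈ holderSections ℂ (dbarClutch (fun w : ℂ => -w ^ 2)) k r :=
  mem_of_hasFDerivAt_of_isClosed (𝕜 := ℝ) _ isClosed_holderSections (𝒥.hasFDerivAt_PT hr k 0)
    (Filter.mem_of_superset (small_mem_nhds hr k) fun _ hy => 𝒥.PT_mem hy) δ

/-- The derivative `dPN 0` takes values in `𝓗N'`. [folklore] -/
theorem dPN_zero_mem (δ : SecPair k r) :
    𝒥.dPN hr k 0 δ ∈ holderSections ℂ (dbarClutch (1 : ℂ → ℂ)) k r :=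
  mem_of_hasFDerivAt_of_isClosed (𝕜 := ℝ) _ isClosed_holderSections (𝒥.hasFDerivAt_PN hr k 0)
    (Filter.mem_of_superset (small_mem_nhds hr k) fun _ hy => 𝒥.PN_mem hy) δ

/-- **The tangent linearisation** `LT = D FT (0) : SecPair k r →L 𝓗T'`. [cite: Wendl2018, Thm. 2.46] -/
def LT : SecPair k r →L[ℝ] holderSections ℂ (dbarClutch (fun w : ℂ => -w ^ 2)) k r :=
  (𝒥.dPT hr k 0).codRestrict _ (𝒥.dPT_zero_mem hr k)

/-- **The normal linearisation** `LN = D FN (0) : SecPair k r →L 𝓗N'`. [cite: Wendl2018, Thm. 2.46] -/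
def LN : SecPair k r →L[ℝ] holderSections ℂ (dbarClutch (1 : ℂ → ℂ)) k r :=
  (𝒥.dPN hr k 0).codRestrict _ (𝒥.dPN_zero_mem hr k)

/-- Values of `LT`. [folklore] -/
@[simp] theorem coe_LT (δ : SecPair k r) :
    ((𝒥.LT hr k δ : holderSections ℂ (dbarClutch (fun w : ℂ => -w ^ 2)) k r) :
      ContDiffHolderFunction ℂ ℂ k r × ContDiffHolderFunction ℂ ℂ k r) = 𝒥.dPT hr k 0 δ := rfl

/-- Values of `LN`. [folklore] -/
@[simp] theorem coe_LN (δ : SecPair k r) :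
    ((𝒥.LN hr k δ : holderSections ℂ (dbarClutch (1 : ℂ → ℂ)) k r) :
      ContDiffHolderFunction ℂ ℂ k r × ContDiffHolderFunction ℂ ℂ k r) = 𝒥.dPN hr k 0 δ := rfl

/-- **`FT` has derivative `LT` at `0`.** [cite: Wendl2018, Thm. 2.46] -/
theorem hasFDerivAt_FT : HasFDerivAt (𝒥.FT hr k) (𝒥.LT hr k) 0 := by
  refine (hasFDerivAt_linearIsometry_comp_iff (𝕜 := ℝ)
    (holderSections ℂ (dbarClutch (fun w : ℂ => -w ^ 2)) k r).subtypeₗᵢ).1 ?_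
  have h1 : (holderSections ℂ (dbarClutch (fun w : ℂ => -w ^ 2)) k r).subtypeₗᵢ.toContinuousLinearMap.comp
      (𝒥.LT hr k) = 𝒥.dPT hr k 0 := ContinuousLinearMap.ext fun _ => rfl
  rw [h1]
  refine (𝒥.hasFDerivAt_PT hr k 0).congr_of_eventuallyEq ?_
  filter_upwards [small_mem_nhds hr k] with y hy
  exact 𝒥.coe_FT_of_small hy

/-- **`FN` has derivative `LN` at `0`.** [cite: Wendl2018, Thm. 2.46] -/
theorem hasFDerivAt_FN : HasFDerivAt (𝒥.FN hr k) (𝒥.LN hr k) 0 := by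
  refine (hasFDerivAt_linearIsometry_comp_iff (𝕜 := ℝ)
    (holderSections ℂ (dbarClutch (1 : ℂ → ℂ)) k r).subtypeₗᵢ).1 ?_
  have h1 : (holderSections ℂ (dbarClutch (1 : ℂ → ℂ)) k r).subtypeₗᵢ.toContinuousLinearMap.comp
      (𝒥.LN hr k) = 𝒥.dPN hr k 0 := ContinuousLinearMap.ext fun _ => rfl
  rw [h1]
  refine (𝒥.hasFDerivAt_PN hr k 0).congr_of_eventuallyEq ?_
  filter_upwards [small_mem_nhds hr k] with y hy
  exact 𝒥.coe_FN_of_small hy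

/-! ### The blocks -/

/-- **The tangent diagonal block** `T₁ δξ = LT (δξ, 0)`. [cite: Wendl2018, Thm. 2.46] -/
def T₁ : holderSections ℂ (fun w : ℂ => -w ^ 2) (k + 1) r →L[ℝ]
    holderSections ℂ (dbarClutch (fun w : ℂ => -w ^ 2)) k r :=
  (𝒥.LT hr k).comp (ContinuousLinearMap.inl ℝ _ _)

/-- **The coupling block** `M δf = LT (0, δf)`. [cite: Wendl2018, Thm. 2.46] -/
def Mop : holderSections ℂ (1 : ℂ → ℂ) (k + 1) r →L[ℝ]
    holderSections ℂ (dbarClutch (fun w : ℂ => -w ^ 2)) k r :=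
  (𝒥.LT hr k).comp (ContinuousLinearMap.inr ℝ _ _)

/-- **The normal diagonal block** `T₂ δf = LN (0, δf)`. [cite: Wendl2018, Thm. 2.46] -/
def T₂ : holderSections ℂ (1 : ℂ → ℂ) (k + 1) r →L[ℝ] holderSections ℂ (dbarClutch (1 : ℂ → ℂ)) k r :=
  (𝒥.LN hr k).comp (ContinuousLinearMap.inr ℝ _ _)

/-- `LT δ = T₁ δ.1 + M δ.2`. [folklore] -/
theorem LT_apply (δ : SecPair k r) : 𝒥.LT hr k δ = 𝒥.T₁ hr k δ.1 + 𝒥.Mop hr k δ.2 := by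
  have h : δ = ContinuousLinearMap.inl ℝ _ _ δ.1 + ContinuousLinearMap.inr ℝ _ _ δ.2 := by simp
  conv_lhs => rw [h]
  rw [map_add]
  rfl

variable {hr k} in
/-- **The normal rows do not see `δξ`**: `LN δ = T₂ δ.2` (`k ≥ 1`). [cite: Wendl2018, Thm. 2.46] -/
theorem LN_apply (hk : 1 ≤ k) (δ : SecPair k r) : 𝒥.LN hr k δ = 𝒥.T₂ hr k δ.2 := by
  refine Subtype.ext ?_
  show 𝒥.dPN hr k 0 δ = 𝒥.dPN hr k 0 (ContinuousLinearMap.inr ℝ _ _ δ.2)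
  exact 𝒥.dPN_zero_eq_of_snd_eq hk _ _ (by simp)

/-! ### Identification of the diagonal blocks (`k ≥ 1`) -/

section Ident

variable {hr k}

/-- `∂ₓ f + I ∂_y f = 2 ∂̄ f`. [folklore] -/
theorem fderiv_add_I_mul_fderiv_eq (f : ℂ → ℂ) (z : ℂ) :
    fderiv ℝ f z 1 + I * fderiv ℝ f z I = (2 : ℝ) • dbarAlong 1 f z := by
  rw [dbarAlong_apply]
  simp only [smul_eq_mul, mul_one, Complex.real_smul, Complex.ofReal_ofNat]
  ring

/-- The `z`-representative of the zero section of the trivial bundle is the zero function.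
[folklore] -/
theorem sec₀_one_coe_zero_eq (j : ℕ) :
    sec₀ (1 : ℂ → ℂ) ((0 : holderSections ℂ (1 : ℂ → ℂ) j r) :
      ContDiffHolderFunction ℂ ℂ j r × ContDiffHolderFunction ℂ ℂ j r) = fun _ => 0 :=
  funext fun z => sec₀_coe_zero (F := ℂ) 1 1 z

/-- The `w`-representative of the zero section of the trivial bundle is the zero function.
[folklore] -/
theorem sec₁_one_coe_zero_eq (j : ℕ) :
    sec₁ (1 : ℂ → ℂ) ((0 : holderSections ℂ (1 : ℂ → ℂ) j r) :
      ContDiffHolderFunction ℂ ℂ j r × ContDiffHolderFunction ℂ ℂ j r) = fun _ => 0 :=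
  funext fun w => sec₁_coe_zero (F := ℂ) 1 1 w

/-- **The tangent diagonal block is `2 ∂̄_T`**: `T₁ = 2 • dbarSec` on `𝓗^{k+1,r}_{-w²}` (`k ≥ 1`).
[cite: Wendl2018, Thm. 2.46] -/
theorem T₁_eq (hk : 1 ≤ k) (ξ : holderSections ℂ (fun w : ℂ => -w ^ 2) (k + 1) r) :
    𝒥.T₁ hr k ξ = (2 : ℝ) • dbarSec neg_sq_clutch_ne_zero differentiableOn_neg_sq_clutch hr ξ := by
  have hin : (ContinuousLinearMap.inl ℝ _ (holderSections ℂ (1 : ℂ → ℂ) (k + 1) r) ξ) = (ξ, 0) := rfl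
  refine ext_of_sec₀_sec₁ (dbarClutch_ne_zero_of neg_sq_clutch_ne_zero) (fun z hz => ?_)
    (fun w hw => ?_)
  · rw [sec₀_of_norm_lt hz, Submodule.coe_smul, sec₀_smul, sec₀_dbarSec]
    show (𝒥.dPT hr k 0 (ContinuousLinearMap.inl ℝ _ _ ξ)).1 z = _
    rw [𝒥.dPT_zero_fst_apply hk, hin]
    simp only [sec₀_one_coe_zero_eq, fderiv_fun_const, Pi.zero_apply, Prod.mk_zero_zero, map_zero,
      add_zero, rhoCut_eq_one hz.le, one_smul]
    exact fderiv_add_I_mul_fderiv_eq _ z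
  · rw [sec₁_of_norm_lt hw, Submodule.coe_smul, sec₁_smul, sec₁_dbarSec]
    show (𝒥.dPT hr k 0 (ContinuousLinearMap.inl ℝ _ _ ξ)).2 w = _
    rw [𝒥.dPT_zero_snd_apply hk, hin]
    simp only [sec₁_one_coe_zero_eq, fderiv_fun_const, Pi.zero_apply, Prod.mk_zero_zero, map_zero,
      add_zero, rhoCut_eq_one hw.le, one_smul]
    exact fderiv_add_I_mul_fderiv_eq _ w

/-- **The normal diagonal block is `2 ∂̄ + A`**: `T₂ = 2 • dbarOne + formMul a₀ a₁ ∘ incl`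
(`k ≥ 1`). [cite: Wendl2018, Thm. 2.46] -/
theorem T₂_eq (hk : 1 ≤ k) (f : holderSections ℂ (1 : ℂ → ℂ) (k + 1) r) :
    𝒥.T₂ hr k f = (2 : ℝ) • dbarOne hr k f +
      formMul 𝒥.aCoeff₀ 𝒥.aCoeff₁ 𝒥.contDiff_aCoeff₀ 𝒥.contDiff_aCoeff₁ 𝒥.aCoeff_clutch hr k
        (inclCLM hr f) := by
  have hin : (ContinuousLinearMap.inr ℝ (holderSections ℂ (fun w : ℂ => -w ^ 2) (k + 1) r) _ f) =
      (0, f) := rfl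
  refine ext_of_sec₀_sec₁ (dbarClutch_ne_zero_of one_clutch_ne_zero) (fun z hz => ?_) (fun w hw => ?_)
  · rw [sec₀_of_norm_lt hz, Submodule.coe_add, sec₀_add, Submodule.coe_smul, sec₀_smul, dbarOne,
      sec₀_dbarSec, sec₀_formMul, sec₀_inclCLM]
    show (𝒥.dPN hr k 0 (ContinuousLinearMap.inr ℝ _ _ f)).1 z = _
    rw [𝒥.dPN_zero_fst_apply hk, hin]
    simp only [rhoCut_eq_one hz.le, one_smul]
    rw [fderiv_add_I_mul_fderiv_eq]
  · rw [sec₁_of_norm_lt hw, Submodule.coe_add, sec₁_add, Submodule.coe_smul, sec₁_smul, dbarOne,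
      sec₁_dbarSec, sec₁_formMul, sec₁_inclCLM]
    show (𝒥.dPN hr k 0 (ContinuousLinearMap.inr ℝ _ _ f)).2 w = _
    rw [𝒥.dPN_zero_snd_apply hk, hin]
    simp only [rhoCut_eq_one hw.le, one_smul]
    rw [fderiv_add_I_mul_fderiv_eq]

/-! ### The bordered diagonal blocks are bijective -/

/-- **The bordered tangent block `(T₁, slice₃)` is bijective** (tangential slice theorem for
`2 ∂̄_T`). [cite: Wendl2018, Thm. 2.46] -/
theorem bijective_T₁_prod_slice₃ (hr0 : 0 < r) (hr1 : r < 1) (hk : 1 ≤ k) :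
    Bijective fun ξ : holderSections ℂ (fun w : ℂ => -w ^ 2) (k + 1) r =>
      (𝒥.T₁ hr1.le k ξ, slice₃ (k + 1) r ξ) := by
  have h := bijective_smul_dbarSec_prod_slice₃ (F := ℂ) k hr0 hr1 (c := (2 : ℝ)) two_ne_zero
  convert h using 2 with ξ
  rw [𝒥.T₁_eq hk]

/-- The halved coefficient field `a₀/2` is smooth. [folklore] -/
theorem contDiff_half_aCoeff₀ : ContDiff ℝ ∞ ((2⁻¹ : ℝ) • 𝒥.aCoeff₀) := by
  have h := 𝒥.contDiff_aCoeff₀.const_smul (2⁻¹ : ℝ)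
  exact h

/-- The halved coefficient field `a₁/2` is smooth. [folklore] -/
theorem contDiff_half_aCoeff₁ : ContDiff ℝ ∞ ((2⁻¹ : ℝ) • 𝒥.aCoeff₁) := by
  have h := 𝒥.contDiff_aCoeff₁.const_smul (2⁻¹ : ℝ)
  exact h

/-- The halved coefficient fields clutch. [folklore] -/
theorem half_aCoeff_clutch :
    IsFormCoeff ((2⁻¹ : ℝ) • 𝒥.aCoeff₀) ((2⁻¹ : ℝ) • 𝒥.aCoeff₁) := by
  intro w hw x
  simp only [Pi.smul_apply, FunLike.coe_smul, 𝒥.aCoeff_clutch w hw x]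
  rw [smul_comm]

/-- `formMul` is homogeneous in the coefficient fields: doubling the operator with halved fields
gives the operator. [folklore] -/
theorem two_smul_formMul_half (j : ℕ) (p : holderSections ℂ (1 : ℂ → ℂ) j r) :
    (2 : ℝ) • formMul ((2⁻¹ : ℝ) • 𝒥.aCoeff₀) ((2⁻¹ : ℝ) • 𝒥.aCoeff₁)
        𝒥.contDiff_half_aCoeff₀ 𝒥.contDiff_half_aCoeff₁ 𝒥.half_aCoeff_clutch hr j p =
      formMul 𝒥.aCoeff₀ 𝒥.aCoeff₁ 𝒥.contDiff_aCoeff₀ 𝒥.contDiff_aCoeff₁ 𝒥.aCoeff_clutch hr j p := by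
  refine ext_of_sec₀_sec₁ (dbarClutch_ne_zero_of one_clutch_ne_zero) (fun z _ => ?_) (fun w _ => ?_)
  · rw [Submodule.coe_smul, sec₀_smul, sec₀_formMul, sec₀_formMul]
    simp only [Pi.smul_apply, FunLike.coe_smul, smul_smul]
    norm_num
  · rw [Submodule.coe_smul, sec₁_smul, sec₁_formMul, sec₁_formMul]
    simp only [Pi.smul_apply, FunLike.coe_smul, smul_smul]
    norm_num

/-- **The bordered normal block `(T₂, ev₀)` is bijective** (automatic transversality for
`2 ∂̄ + A = 2 (∂̄ + A/2)`). [cite: Wendl2018, Thm. 2.46] -/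
theorem bijective_T₂_prod_eval (hr0 : 0 < r) (hr1 : r < 1) (hk : 1 ≤ k) :
    Bijective fun f : holderSections ℂ (1 : ℂ → ℂ) (k + 1) r =>
      (𝒥.T₂ hr1.le k f, eval₀CLM (F := ℂ) (1 : ℂ → ℂ) (k + 1) r 0 f) := by
  have h := bijective_dbar_add_formMul_prod_eval ((2⁻¹ : ℝ) • 𝒥.aCoeff₀) ((2⁻¹ : ℝ) • 𝒥.aCoeff₁)
    𝒥.contDiff_half_aCoeff₀ 𝒥.contDiff_half_aCoeff₁ 𝒥.half_aCoeff_clutch hr0 hr1 k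
    (z₀ := 0) (by simp)
  -- `T₂ f = 2 • (dbarOne f + formMul (a/2) (incl f))`
  have hT : ∀ f : holderSections ℂ (1 : ℂ → ℂ) (k + 1) r, 𝒥.T₂ hr1.le k f =
      (2 : ℝ) • ((dbarOne hr1.le k + (formMul ((2⁻¹ : ℝ) • 𝒥.aCoeff₀) ((2⁻¹ : ℝ) • 𝒥.aCoeff₁)
        𝒥.contDiff_half_aCoeff₀ 𝒥.contDiff_half_aCoeff₁ 𝒥.half_aCoeff_clutch
        hr1.le k).comp (inclCLM hr1.le)) f) := by
    intro f
    rw [𝒥.T₂_eq hk, show ∀ (A B : holderSections ℂ (1 : ℂ → ℂ) (k + 1) r →L[ℝ]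
        holderSections ℂ (dbarClutch (1 : ℂ → ℂ)) k r) (g : holderSections ℂ (1 : ℂ → ℂ) (k + 1) r),
        (A + B) g = A g + B g from fun _ _ _ => rfl, ContinuousLinearMap.comp_apply, smul_add,
      𝒥.two_smul_formMul_half]
  constructor
  · intro f g hfg
    simp only [Prod.mk.injEq] at hfg
    apply h.1
    simp only [Prod.mk.injEq]
    refine ⟨?_, hfg.2⟩
    have h2 := hfg.1
    rw [hT, hT] at h2
    exact smul_right_injective _ (two_ne_zero (α := ℝ)) h2
  · rintro ⟨η, c⟩
    obtain ⟨f, hf⟩ := h.2 ((2⁻¹ : ℝ) • η, c)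
    simp only [Prod.mk.injEq] at hf
    refine ⟨f, ?_⟩
    simp only [Prod.mk.injEq]
    refine ⟨?_, hf.2⟩
    rw [hT, hf.1, smul_smul]
    norm_num

/-! ### The bordered linearisation is an isomorphism -/

/-- **The bordered linearisation at the zero section as a linear homeomorphism**
`SecPair k r ≃L (𝓗T' × 𝓗N') × ((ℂ × ℂ × ℂ) × ℂ)`: block triangular with bijective bordered
diagonal blocks (tangential slice ⊕ automatic transversality), Banach open mapping.
[cite: Wendl2018, Thm. 2.46] -/
def linEquiv (hr0 : 0 < r) (hr1 : r < 1) (hk : 1 ≤ k) :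
    SecPair k r ≃L[ℝ] (holderSections ℂ (dbarClutch (fun w : ℂ => -w ^ 2)) k r ×
      holderSections ℂ (dbarClutch (1 : ℂ → ℂ)) k r) × ((ℂ × ℂ × ℂ) × ℂ) :=
  blockTriangularEquiv (𝒥.T₁ hr1.le k) (slice₃ (k + 1) r) (𝒥.T₂ hr1.le k)
    (eval₀CLM (F := ℂ) (1 : ℂ → ℂ) (k + 1) r 0) (𝒥.Mop hr1.le k)
    (𝒥.bijective_T₁_prod_slice₃ hr0 hr1 hk) (𝒥.bijective_T₂_prod_eval hr0 hr1 hk)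

/-- **Values of the bordered linearisation**:
`linEquiv δ = ((LT δ, LN δ), (slice₃ δ.1, δ.2(0)))`. [cite: Wendl2018, Thm. 2.46] -/
theorem linEquiv_apply (hr0 : 0 < r) (hr1 : r < 1) (hk : 1 ≤ k) (δ : SecPair k r) :
    𝒥.linEquiv hr0 hr1 hk δ =
      ((𝒥.LT hr1.le k δ, 𝒥.LN hr1.le k δ),
        (slice₃ (k + 1) r δ.1, eval₀CLM (F := ℂ) (1 : ℂ → ℂ) (k + 1) r 0 δ.2)) := by
  rw [linEquiv, blockTriangularEquiv_apply, 𝒥.LT_apply, 𝒥.LN_apply hk]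

/-- The bordered linearisation as a continuous linear MAP (the underlying map of `linEquiv`).
[folklore] -/
theorem coe_linEquiv (hr0 : 0 < r) (hr1 : r < 1) (hk : 1 ≤ k) :
    (𝒥.linEquiv hr0 hr1 hk : SecPair k r →L[ℝ] _) =
      ((𝒥.LT hr1.le k).prod (𝒥.LN hr1.le k)).prod
        (((slice₃ (k + 1) r).comp (ContinuousLinearMap.fst ℝ _ _)).prod
          ((eval₀CLM (F := ℂ) (1 : ℂ → ℂ) (k + 1) r 0).comp (ContinuousLinearMap.snd ℝ _ _))) := by
  exact ContinuousLinearMap.ext fun δ => 𝒥.linEquiv_apply hr0 hr1 hk δ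

end Ident

end SphereACData

end SphereCR

end Literature.Geometry.Symplectic

end
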